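import Literature.NumberTheory.EllipticCurves.BSDSelmerPParityProofs
import HarnessLib

/-!
# bsd.S34: Smith's Corollary 1.3 from Theorem 1.1 and `2`-parity, as printed
(proofs for `Literature.NumberTheory.EllipticCurves.BSDSelmer`)

D-0014 keeps `Literature/` sorry-free by stating cited results as named facts `def X : Prop`.
`BSDSelmer` states, for an elliptic `W / ℚ`, the two bsd.S34 facts of A. Smith, *The Birch and
Swinnerton-Dyer conjecture implies Goldfeld's conjecture*, arXiv:2503.17619 (2025), §1:

* `smith_selmerCorank_density W` — **Thm. 1.1**: among the quadratic twists `E^d` the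
  `2^∞`-Selmer corank `r_{2^∞}(E^d)` is `0` with density `1/2`, `1` with density `1/2`, and `r`
  with density `0` for each `r ≥ 2`;
* `smith_rank_of_rootNumber W` — **Cor. 1.3**: "Choose any elliptic curve `E/ℚ`. Then, among the
  quadratic twists `E^d` with `w(E^d) = +1`, `100%` have rank `0`. Further, among the quadratic
  twists with `w(E^d) = -1`, `100%` have rank at most `1`."

The printed proof of Cor. 1.3 is one sentence (§1, after Cor. 1.2): "Another easy consequence of
Theorem 1.1 and (1.2) is the following", where (1.1) is the unconditional inequality
`r_MW(E^d) ≤ r_{2^∞}(E^d)` and (1.2) is `(-1)^{r_{2^∞}(E^d)} = (-1)^{r_an(E^d)} = w(E^d)`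
("From [Monsky96]"). This file PROVES that deduction for the tree's statements:

* `twistDensity_one_mono`, `twistDensity_or_of_disjoint` — the two elementary properties of the
  natural density over squarefree integers (`twistDensity`, `BSDSelmer`) that the sentence uses:
  a superset of a density-`1` set has density `1` (squeeze), and densities of disjoint sets add;
* `twistDensity_selmerCorankTwoInfty_le_one_of` — from Thm. 1.1, `r_{2^∞}(E^d) ≤ 1` for a set of
  squarefree `d` of density `1/2 + 1/2 = 1`;
* `smith_rank_le_one_density_of` — from Thm. 1.1 and (1.1) alone (no parity, no root number),
  `rank E^d(ℚ) ≤ 1` for a density-`1` set of squarefree `d`; (1.1) is the *proved* corank identity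
  `corank Sel_{p^∞} = rank + corank Ш[p^∞]`
  (`WeierstrassCurve.selmerCorank_eq_mordellWeilRank_add_holds`, `SelmerCorankHolds`;
  Greenberg 1999, §1) at `p = 2`;
* `smith_rank_of_rootNumber_of_facts` — **Cor. 1.3 from Thm. 1.1 (`hS`) and `2`-parity** in the
  form (1.2), `(-1)^{corank Sel_{2^∞}(E'/ℚ)} = w(E')` for every elliptic `E'/ℚ`, i.e. the bsd.S19
  fact `p_parity E' 2` (`hpar`; Dokchitser–Dokchitser 2010, Thm. 1.4, whose case `p = 2` is
  Monsky 1996): on the density-`1` set where `r_{2^∞}(E^d) ≤ 1`, `w(E^d) = +1` forces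
  `r_{2^∞}(E^d)` even, hence `0`, hence rank `0`; and rank `≤ r_{2^∞}(E^d) ≤ 1` always;
* `smith_rank_of_rootNumber_of_facts_of_exists_isNewformOf` — the same with `hpar` replaced by
  its sources in the tree: Monsky's congruence `monsky_selmerCorank_two_mod_two_eq`
  (`BSDSelmerParityDokchitserProofs`) and the Modularity Theorem
  `Literature.NumberTheory.EllipticCurves.ModularForms.exists_isNewformOf` (BCDT 2001, Thm. A),
  through `p_parity_of_selmerCorank_mod_two_eq_of_exists_isNewformOf` (`BSDSelmerParityProofs`).

So `smith_rank_of_rootNumber W` rests, up to proved theorems, on exactly: Smith's Thm. 1.1 for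
`W` (`smith_selmerCorank_density W`), Monsky's `2`-parity congruence, and modularity.
`smith_rank_of_rootNumber_holds` itself is not here: Thm. 1.1 (arXiv:2503.17619 together with
Smith, arXiv:2207.05674) is not formalised — the fact is reduced, not discharged, and not weakened.
Only theorems are added; no definition and no statement of `BSDSelmer` is changed.

Density convention. Thm. 1.1 is printed with `d` ranging over all of `ℤ^{≠0}` and denominator
`2H`; the tree's `twistDensity` (used by both bsd.S34 facts) counts squarefree `d` with `|d| ≤ X`
against all squarefree `d` with `|d| ≤ X`. The deduction below is insensitive to the convention:
it only uses monotonicity and additivity of the density and pointwise implications between the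
predicates.

## References

* [arXiv250317619] A. Smith, *The Birch and Swinnerton-Dyer conjecture implies Goldfeld's
  conjecture*, arXiv:2503.17619 (2025): §1, Thm. 1.1, displays (1.1)–(1.2), Cor. 1.3.
* [DokchitserDokchitserAnnals2010] T. Dokchitser, V. Dokchitser, Ann. of Math. 172 (2010),
  Thm. 1.4 (= Thm. 4.19; case `p = 2`: Monsky 1996).
* [Monsky1996] P. Monsky, *Generalizing the Birch–Stephens theorem. I. Modular curves*, Math. Z.
  221 (1996), 415–420.
* [Greenberg1999LNM] R. Greenberg, *Iwasawa theory for elliptic curves*, LNM 1716 (1999), §1.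
* [BCDTJAMS2001] C. Breuil, B. Conrad, F. Diamond, R. Taylor, J. Amer. Math. Soc. 14 (2001), Thm. A.
-/

noncomputable section

open scoped Classical

open Filter Topology WeierstrassCurve

namespace Literature.NumberTheory.EllipticCurves

/-! ### Natural density over squarefree integers: monotonicity and additivity -/

/-- The counting set `{d squarefree, |d| ≤ X, P d}` of `twistDensity` is finite (it lies in
`[-X, X]`). [folklore] -/
theorem finite_setOf_squarefree_abs_le (X : ℕ) (P : ℤ → Prop) :
    {d : ℤ | Squarefree d ∧ |d| ≤ X ∧ P d}.Finite :=
  (Set.finite_Icc (-(X : ℤ)) X).subset fun _ hd ↦ abs_le.mp hd.2.1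

/-- The reference set `{d squarefree, |d| ≤ X}` of `twistDensity` is finite. [folklore] -/
theorem finite_setOf_squarefree_abs_le' (X : ℕ) :
    {d : ℤ | Squarefree d ∧ |d| ≤ X}.Finite :=
  (Set.finite_Icc (-(X : ℤ)) X).subset fun _ hd ↦ abs_le.mp hd.2

/-- **Monotonicity at density `1`.** If the squarefree `d` with `P d` have density `1` and `P d`
implies `Q d` for squarefree `d`, then the squarefree `d` with `Q d` have density `1`: for every
`X` the `Q`-proportion is squeezed between the `P`-proportion and `1`. [folklore] -/
theorem twistDensity_one_mono {P Q : ℤ → Prop} (hPQ : ∀ d, Squarefree d → P d → Q d)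
    (hP : twistDensity P 1) : twistDensity Q 1 := by
  unfold twistDensity at hP ⊢
  refine tendsto_of_tendsto_of_tendsto_of_le_of_le hP tendsto_const_nhds (fun X ↦ ?_) fun X ↦ ?_
  · have hle : Nat.card {d : ℤ | Squarefree d ∧ |d| ≤ X ∧ P d} ≤
        Nat.card {d : ℤ | Squarefree d ∧ |d| ≤ X ∧ Q d} :=
      Nat.card_mono (finite_setOf_squarefree_abs_le X Q)
        fun d hd ↦ ⟨hd.1, hd.2.1, hPQ d hd.1 hd.2.2⟩
    dsimp only
    gcongr
  · have hle : Nat.card {d : ℤ | Squarefree d ∧ |d| ≤ X ∧ Q d} ≤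
        Nat.card {d : ℤ | Squarefree d ∧ |d| ≤ X} :=
      Nat.card_mono (finite_setOf_squarefree_abs_le' X) fun d hd ↦ ⟨hd.1, hd.2.1⟩
    dsimp only
    exact div_le_one_of_le₀ (by exact_mod_cast hle) (Nat.cast_nonneg _)

/-- **Additivity.** If the squarefree `d` with `P d` have density `a`, those with `Q d` have
density `b`, and no `d` satisfies both, then the squarefree `d` with `P d ∨ Q d` have density
`a + b` (the counting set is a disjoint union for every `X`). [folklore] -/
theorem twistDensity_or_of_disjoint {P Q : ℤ → Prop} {a b : ℝ} (hPQ : ∀ d, P d → ¬ Q d)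
    (hP : twistDensity P a) (hQ : twistDensity Q b) :
    twistDensity (fun d ↦ P d ∨ Q d) (a + b) := by
  unfold twistDensity at hP hQ ⊢
  refine (hP.add hQ).congr fun X ↦ ?_
  have hunion : {d : ℤ | Squarefree d ∧ |d| ≤ X ∧ (P d ∨ Q d)} =
      {d : ℤ | Squarefree d ∧ |d| ≤ X ∧ P d} ∪ {d : ℤ | Squarefree d ∧ |d| ≤ X ∧ Q d} := by
    ext d
    simp only [Set.mem_setOf_eq, Set.mem_union]
    tauto
  have hdisj : Disjoint {d : ℤ | Squarefree d ∧ |d| ≤ X ∧ P d}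
      {d : ℤ | Squarefree d ∧ |d| ≤ X ∧ Q d} :=
    Set.disjoint_left.mpr fun d hp hq ↦ hPQ d hp.2.2 hq.2.2
  have hcard : (Nat.card {d : ℤ | Squarefree d ∧ |d| ≤ X ∧ (P d ∨ Q d)} : ℝ) =
      Nat.card {d : ℤ | Squarefree d ∧ |d| ≤ X ∧ P d} +
        Nat.card {d : ℤ | Squarefree d ∧ |d| ≤ X ∧ Q d} := by
    rw [← Nat.cast_add, Nat.card_coe_set_eq, hunion,
      Set.ncard_union_eq hdisj (finite_setOf_squarefree_abs_le X P)
        (finite_setOf_squarefree_abs_le X Q),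
      Nat.card_coe_set_eq, Nat.card_coe_set_eq]
  dsimp only
  rw [hcard, add_div]

/-! ### Cor. 1.3 from Thm. 1.1, (1.1) and (1.2) -/

variable (W : WeierstrassCurve ℚ)

/-- **From Thm. 1.1: `r_{2^∞}(E^d) ≤ 1` for a density-`1` set of squarefree `d`.** The sets
`{r_{2^∞}(E^d) = 0}` and `{r_{2^∞}(E^d) = 1}` are disjoint of densities `1/2` and `1/2`
(`smith_selmerCorank_density W`, first two clauses), so their union has density `1`
(`twistDensity_or_of_disjoint`). [cite: arXiv250317619, Thm. 1.1] -/
theorem twistDensity_selmerCorankTwoInfty_le_one_of (hS : smith_selmerCorank_density W) :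
    twistDensity (fun d ↦ d ≠ 0 ∧ selmerCorankTwoInfty (W.quadraticTwist d) ≤ 1) 1 := by
  obtain ⟨h0, h1, -⟩ := hS
  have h01 := twistDensity_or_of_disjoint (fun d hd0 hd1 ↦ by omega) h0 h1
  rw [add_halves] at h01
  refine twistDensity_one_mono (fun d _ hd ↦ ?_) h01
  rcases hd with ⟨hd, hc⟩ | ⟨hd, hc⟩
  · exact ⟨hd, hc.le.trans zero_le_one⟩
  · exact ⟨hd, hc.le⟩

variable [W.IsElliptic]

/-- **Display (1.1) of Smith, §1, for the tree's objects: `r_MW(E^d) ≤ r_{2^∞}(E^d)`** for every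
`d ≠ 0` — the proved corank identity `corank_{ℤ_2} Sel_{2^∞} = rank + corank_{ℤ_2} Ш[2^∞]`
(`WeierstrassCurve.selmerCorank_eq_mordellWeilRank_add_holds`, Greenberg 1999, §1) for the
elliptic curve `E^d = W.quadraticTwist d` (`isElliptic_quadraticTwist`), with
`selmerCorankTwoInfty = selmerCorank · 2` (`selmerCorankTwoInfty_eq`).
[cite: arXiv250317619, §1 display (1.1)] [cite: Greenberg1999LNM, §1 pp. 54–57] -/
theorem mordellWeilRank_quadraticTwist_le_selmerCorankTwoInfty {d : ℤ} (hd : d ≠ 0) :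
    (W.quadraticTwist d).mordellWeilRank ≤ selmerCorankTwoInfty (W.quadraticTwist d) := by
  haveI := W.isElliptic_quadraticTwist (d := (d : ℚ)) (by exact_mod_cast hd)
  rw [selmerCorankTwoInfty_eq,
    (W.quadraticTwist (d : ℚ)).selmerCorank_eq_mordellWeilRank_add_holds 2]
  exact Nat.le_add_right _ _

/-- **From Thm. 1.1 and (1.1) alone: rank `≤ 1` for a density-`1` set of twists.** For every
elliptic `W/ℚ`, the squarefree `d` with `rank E^d(ℚ) ≤ 1` (as an implication from `d ≠ 0`, as in
`smith_rank_of_rootNumber`) have density `1`: on the density-`1` set of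
`twistDensity_selmerCorankTwoInfty_le_one_of`, `rank ≤ r_{2^∞}(E^d) ≤ 1`
(`mordellWeilRank_quadraticTwist_le_selmerCorankTwoInfty`). No parity and no root number is
needed for this half of Cor. 1.3. [cite: arXiv250317619, Thm. 1.1 and Cor. 1.3] -/
theorem smith_rank_le_one_density_of (hS : smith_selmerCorank_density W) :
    twistDensity (fun d ↦ d ≠ 0 → (W.quadraticTwist d).mordellWeilRank ≤ 1) 1 :=
  twistDensity_one_mono
    (fun _ _ hd _ ↦ (mordellWeilRank_quadraticTwist_le_selmerCorankTwoInfty W hd.1).trans hd.2)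
    (twistDensity_selmerCorankTwoInfty_le_one_of W hS)

/-- **Smith, arXiv:2503.17619, Cor. 1.3, deduced as printed from Thm. 1.1 and (1.2).** For an
elliptic `W/ℚ`: if Thm. 1.1 holds for `W` (`hS : smith_selmerCorank_density W`) and the
`2`-parity identity (1.2), `(-1)^{corank_{ℤ_2} Sel_{2^∞}(E'/ℚ)} = w(E')`, holds for every
elliptic curve `E'/ℚ` (`hpar`, the bsd.S19 fact `p_parity E' 2`; Dokchitser–Dokchitser 2010,
Thm. 1.4, case `p = 2` due to Monsky 1996, which is Smith's reference "[Monsky96]"), then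
`smith_rank_of_rootNumber W`: among squarefree `d`, density `1` of
`d ≠ 0 → w(E^d) = +1 → rank E^d(ℚ) = 0` and of `d ≠ 0 → w(E^d) = -1 → rank E^d(ℚ) ≤ 1`.
Proof, as printed: both sets contain the density-`1` set `{r_{2^∞}(E^d) ≤ 1}`
(`twistDensity_selmerCorankTwoInfty_le_one_of`), since for such `d ≠ 0`, (1.1) gives
`rank ≤ r_{2^∞}(E^d) ≤ 1`, and if moreover `w(E^d) = +1` then (1.2) makes `r_{2^∞}(E^d)` even,
hence `0`, hence rank `0`; conclude by `twistDensity_one_mono`.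
[cite: arXiv250317619, Cor. 1.3 (from Thm. 1.1 and (1.2))] [cite: DokchitserDokchitserAnnals2010, Thm. 1.4] -/
theorem smith_rank_of_rootNumber_of_facts (hS : smith_selmerCorank_density W)
    (hpar : ∀ (E : WeierstrassCurve ℚ) [E.IsElliptic], p_parity E 2) :
    smith_rank_of_rootNumber W := by
  refine ⟨twistDensity_one_mono (fun d _ hd hd0 hw ↦ ?_)
      (twistDensity_selmerCorankTwoInfty_le_one_of W hS),
    twistDensity_one_mono (fun d _ hd hd0 _ ↦ hd hd0) (smith_rank_le_one_density_of W hS)⟩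
  obtain ⟨-, hc⟩ := hd
  have hrk := mordellWeilRank_quadraticTwist_le_selmerCorankTwoInfty W hd0
  haveI := W.isElliptic_quadraticTwist (d := (d : ℚ)) (by exact_mod_cast hd0)
  have h2 : (-1 : ℤ) ^ (W.quadraticTwist (d : ℚ)).selmerCorank 2 =
      (W.quadraticTwist (d : ℚ)).rootNumber := hpar _
  rw [hw, ← selmerCorankTwoInfty_eq] at h2
  have hc0 : selmerCorankTwoInfty (W.quadraticTwist (d : ℚ)) ≠ 1 := fun h1 ↦ by
    rw [h1] at h2
    norm_num at h2
  omega

/-- **Cor. 1.3 from Thm. 1.1, Monsky's `2`-parity congruence and the Modularity Theorem.** As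
`smith_rank_of_rootNumber_of_facts`, with the `2`-parity input `p_parity E' 2` replaced by its
sources in the tree: Monsky's congruence `corank_{ℤ_2} Sel_{2^∞}(E'/ℚ) ≡ ord_{s=1} L(E', s) (mod 2)`
(`hMon : monsky_selmerCorank_two_mod_two_eq`, Dokchitser–Dokchitser 2010, §4.6, case `p = 2` of
Thm. 4.19, citing Monsky 1996) and the parity of the analytic rank from the functional equation,
i.e. the Modularity Theorem (`hmod`, BCDT 2001, Thm. A), combined by
`p_parity_of_selmerCorank_mod_two_eq_of_exists_isNewformOf` (`BSDSelmerParityProofs`). So the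
fact `smith_rank_of_rootNumber W` rests, up to proved theorems, on Smith's Thm. 1.1 for `W`,
Monsky 1996 and modularity. [cite: arXiv250317619, Cor. 1.3] [cite: DokchitserDokchitserAnnals2010, §4.6, proof of Thm. 4.19 (case p = 2)] [cite: BCDTJAMS2001, Thm. A] -/
theorem smith_rank_of_rootNumber_of_facts_of_exists_isNewformOf
    (hmod : Literature.NumberTheory.EllipticCurves.ModularForms.exists_isNewformOf)
    (hMon : monsky_selmerCorank_two_mod_two_eq) (hS : smith_selmerCorank_density W) :
    smith_rank_of_rootNumber W :=
  smith_rank_of_rootNumber_of_facts W hS fun E _ ↦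
    p_parity_of_selmerCorank_mod_two_eq_of_exists_isNewformOf E 2 hmod (hMon.apply E)

end Literature.NumberTheory.EllipticCurves

end
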